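import Summits.QuantumFields.YangMills.Theorems.F4SubCurvatureDoorShortRootRigidityConePackaging
import Mathlib
import HarnessLib

/-!
# LINE g21-C «aperture bootstrap» (crux ⟨stmt-QuantumFields-23035⟩ `F4SubCurvatureDoor.ShortRootRigidity`), THE STEP R-S3d
# `stub_planarApertureStep : FlatDoubleEdge → PlanarApertureStep` — FILE 2, part A: frame data, the FILE 1 / FILE 2 interface, and the
# frame transforms from the SUPPORT condition (STUB-PLAN `Lines/aperture_bootstrap_stubplans.md` H1, H2; owner-approved FILE 1 / FILE 2
# split 2026-08-29T13:54:13Z: FILE 1 = H1–H3 by sfw-p2 g75, FILE 2 = H0 + H4–H10 by w3 g38)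

Contents (all kernel-checked, Mathlib + the tree only):
* frame data `dotU z = z·u₊`, `dotUperp z = z·u₊^⊥` (`u₊ = (1/2, √3/2)`, `u₊^⊥ = (−√3/2, 1/2)`), `rot`, tubes `T0 τ = {|Im β| < τ Re ζ}`,
  `Tplus τ = rot⁻¹(T0 τ)`; transforms `F0 μ (ζ, β) = ∫ e^{−ζE} cos(βp) dμ`, `Fplus μ = F0 μ ∘ rot`;
* the INTERFACE Props `FrameAgreement τ` (= H3: `F0 = Fplus` on `T0 ∩ Tplus`) and `FrameGluing τ` (= H1–H3, clauses (a)–(e));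
* H1/H2 PROVED from `HasAperture μ τ` (`τ|p| ≤ E` a.e.): `differentiableOn_F0` (dominated holomorphic parameter integral,
  `Literature.Analysis.Complex.differentiableOn_integral_of_dominated`), the majorant `norm_F0_le : ‖F0 μ z‖ ≤ k(Re ζ − |Im β|/τ, 0)`,
  `differentiableOn_Fplus`, `norm_Fplus_le`; hence `frameGluing_of_frameAgreement`; the axis function `s ↦ k(s, 0) = ∫ e^{−sE} dμ`
  is non-negative and antitone (`k_axis_nonneg`, `k_axis_antitone`); `F0` is even in `β` (`F0_neg_snd`).
(H4, H5: `…PlanarStepEdge`; H6–H10: `…PlanarApertureStep`.)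

HONEST LABEL: helper toward the OPEN stub :137 of an OPEN line; no stub is closed here; (C), ⟨23035⟩, ⟨23125⟩, R2d and the
Yang–Mills mass gap remain OPEN; no summit is proved by a line.
-/

noncomputable section

namespace Summit.QuantumFields.YangMills.Theorems.F4SubCurvatureDoorPlanarApertureStepRegistered

open MeasureTheory Filter Topology Set Metric Complex
open scoped BigOperators NNReal ENNReal
open Summit.QuantumFields.YangMills.Theorems.F4SubCurvatureDoorSliceDensityRegistered (E2)
open Summit.QuantumFields.YangMills.Theorems.F4SubCurvatureDoorSliceInClassRegistered (InPlanarClass)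
open Summit.QuantumFields.YangMills.Theorems.F4SubCurvatureDoorPlanarLaplaceFourier (ae_energy_nonneg)
open Summit.QuantumFields.YangMills.Theorems.F4SubCurvatureDoorPlanarNarrowTube (norm_cos_le norm_kernel_le)
open Summit.QuantumFields.YangMills.Cruxes.ShortRootRigidity.AngularType (mk2)
open Summit.QuantumFields.YangMills.Theorems.F4SubCurvatureDoorConePackagingRegistered (IsPlanarLF HasAperture mk2_def)

/-! ## The frame data: `u₊ = (1/2, √3/2)`, `u₊^⊥ = (−√3/2, 1/2)` -/

/-- `z·u₊ = ζ/2 + (√3/2)β` (ℂ-bilinear pairing of `z = (ζ, β)` with the frame vector `u₊ = (1/2, √3/2)`). -/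
def dotU (z : ℂ × ℂ) : ℂ := ((1 / 2 : ℝ) : ℂ) * z.1 + ((Real.sqrt 3 / 2 : ℝ) : ℂ) * z.2

/-- `z·u₊^⊥ = −(√3/2)ζ + β/2` (pairing with `u₊^⊥ = (−√3/2, 1/2)`). -/
def dotUperp (z : ℂ × ℂ) : ℂ := ((-(Real.sqrt 3 / 2) : ℝ) : ℂ) * z.1 + ((1 / 2 : ℝ) : ℂ) * z.2

/-- The frame change `z ↦ (z·u₊, z·u₊^⊥)`. -/
def rot (z : ℂ × ℂ) : ℂ × ℂ := (dotU z, dotUperp z)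

/-- The frame-`0` tube of aperture `τ`: `T₀ = {|Im β| < τ Re ζ}`. -/
def T0 (τ : ℝ) : Set (ℂ × ℂ) := {z | |z.2.im| < τ * z.1.re}

/-- The frame-`+` tube of aperture `τ`: `T₊ = {|Im(z·u₊^⊥)| < τ Re(z·u₊)}` (the preimage of `T₀` under `rot`). -/
def Tplus (τ : ℝ) : Set (ℂ × ℂ) := {z | |(dotUperp z).im| < τ * (dotU z).re}

/-- The frame-`0` Laplace–Fourier transform `F₀(ζ, β) = ∫ e^{−ζE} cos(βp) dμ(E, p)`. -/
def F0 (μ : Measure (ℝ × ℝ)) (q : ℂ × ℂ) : ℂ :=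
  ∫ z : ℝ × ℝ, Complex.exp (-(q.1 * (z.1 : ℂ))) * Complex.cos (q.2 * (z.2 : ℂ)) ∂μ

/-- The frame-`+` function `F₊ = F₀ ∘ rot`. -/
def Fplus (μ : Measure (ℝ × ℝ)) (q : ℂ × ℂ) : ℂ := F0 μ (rot q)

/-- **The interface to part H3 of the STUB-PLAN («frame agreement», the one analytic-continuation step):** for every kernel of the
planar class, every Laplace–Fourier representing measure of aperture `τ` has `F₀ = F₊` on `T₀ ∩ T₊`. [problem-side definition] -/
def FrameAgreement (τ : ℝ) : Prop :=
  ∀ (k : E2 → ℝ) (μ : Measure (ℝ × ℝ)), InPlanarClass k → IsPlanarLF k μ → HasAperture μ τ →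
    Set.EqOn (F0 μ) (Fplus μ) (T0 τ ∩ Tplus τ)

/-- **«FRAME GLUING» — the full output of STUB-PLAN H1–H3** (the owner-approved FILE 1 / FILE 2 interface, 2026-08-29T13:54:13Z):
(a) holomorphy of `F₀` on `T₀`, (b) the frame-`0` majorant, (c) holomorphy of `F₊` on `T₊`, (d) the frame-`+` majorant, (e) agreement on
`T₀ ∩ T₊`.  Clauses (a)–(d) are PROVED below from the support condition (`frameGluing_of_frameAgreement`); (e) is FILE 1.
[problem-side definition] -/
def FrameGluing (τ : ℝ) : Prop :=
  ∀ (k : E2 → ℝ) (μ : Measure (ℝ × ℝ)), InPlanarClass k → IsPlanarLF k μ → HasAperture μ τ →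
    DifferentiableOn ℂ (F0 μ) (T0 τ) ∧
    (∀ z ∈ T0 τ, ‖F0 μ z‖ ≤ k (mk2 (z.1.re - |z.2.im| / τ) 0)) ∧
    DifferentiableOn ℂ (Fplus μ) (Tplus τ) ∧
    (∀ z ∈ Tplus τ, ‖Fplus μ z‖ ≤ k (mk2 ((dotU z).re - |(dotUperp z).im| / τ) 0)) ∧
    Set.EqOn (F0 μ) (Fplus μ) (T0 τ ∩ Tplus τ)

/-! ## Elementary facts about the frame data -/

/-- Real part of `z·u₊`. -/
@[simp] theorem dotU_re (z : ℂ × ℂ) : (dotU z).re = z.1.re / 2 + Real.sqrt 3 / 2 * z.2.re := by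
  simp only [dotU, add_re, re_ofReal_mul]; ring

/-- Imaginary part of `z·u₊`. -/
@[simp] theorem dotU_im (z : ℂ × ℂ) : (dotU z).im = z.1.im / 2 + Real.sqrt 3 / 2 * z.2.im := by
  simp only [dotU, add_im, im_ofReal_mul]; ring

/-- Real part of `z·u₊^⊥`. -/
@[simp] theorem dotUperp_re (z : ℂ × ℂ) : (dotUperp z).re = -(Real.sqrt 3 / 2) * z.1.re + z.2.re / 2 := by
  simp only [dotUperp, add_re, re_ofReal_mul]; ring

/-- Imaginary part of `z·u₊^⊥`. -/
@[simp] theorem dotUperp_im (z : ℂ × ℂ) : (dotUperp z).im = -(Real.sqrt 3 / 2) * z.1.im + z.2.im / 2 := by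
  simp only [dotUperp, add_im, im_ofReal_mul]; ring

/-- Additivity of `z·u₊`. -/
theorem dotU_add (z w : ℂ × ℂ) : dotU (z + w) = dotU z + dotU w := by
  simp only [dotU, Prod.fst_add, Prod.snd_add]; ring

/-- Additivity of `z·u₊^⊥`. -/
theorem dotUperp_add (z w : ℂ × ℂ) : dotUperp (z + w) = dotUperp z + dotUperp w := by
  simp only [dotUperp, Prod.fst_add, Prod.snd_add]; ring

/-- `(z − w)·u₊ = z·u₊ − w·u₊`. -/
theorem dotU_sub (z w : ℂ × ℂ) : dotU (z - w) = dotU z - dotU w := by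
  simp only [dotU, Prod.fst_sub, Prod.snd_sub]; ring

/-- `(z − w)·u₊^⊥ = z·u₊^⊥ − w·u₊^⊥`. -/
theorem dotUperp_sub (z w : ℂ × ℂ) : dotUperp (z - w) = dotUperp z - dotUperp w := by
  simp only [dotUperp, Prod.fst_sub, Prod.snd_sub]; ring

/-- `rot` is ℂ-differentiable. -/
theorem differentiable_rot : Differentiable ℂ rot := by
  unfold rot dotU dotUperp; fun_prop

/-- `T₊ = rot⁻¹(T₀)`. -/
theorem mem_Tplus_iff {τ : ℝ} (z : ℂ × ℂ) : z ∈ Tplus τ ↔ rot z ∈ T0 τ := Iff.rfl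

/-- `T₀` is open. -/
theorem isOpen_T0 (τ : ℝ) : IsOpen (T0 τ) := by
  have h1 : Continuous fun z : ℂ × ℂ => |z.2.im| := by fun_prop
  have h2 : Continuous fun z : ℂ × ℂ => τ * z.1.re := by fun_prop
  exact isOpen_lt h1 h2

/-- `T₊` is open. -/
theorem isOpen_Tplus (τ : ℝ) : IsOpen (Tplus τ) :=
  (isOpen_T0 τ).preimage differentiable_rot.continuous

/-- The time shift `z ↦ z + (1, 0)` raises the `T₀`-margin. -/
theorem add_one_mem_T0 {τ : ℝ} (hτ : 0 ≤ τ) {z : ℂ × ℂ} (hz : z ∈ T0 τ) : z + ((1 : ℂ), (0 : ℂ)) ∈ T0 τ := by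
  simp only [T0, mem_setOf_eq, Prod.snd_add, Prod.fst_add, add_zero, add_re, one_re] at hz ⊢
  nlinarith

/-- The time shift raises the `T₊`-margin (`u₀·u₊ = 1/2 > 0`, `u₀·u₊^⊥` real). -/
theorem add_one_mem_Tplus {τ : ℝ} (hτ : 0 ≤ τ) {z : ℂ × ℂ} (hz : z ∈ Tplus τ) : z + ((1 : ℂ), (0 : ℂ)) ∈ Tplus τ := by
  simp only [Tplus, mem_setOf_eq, dotUperp_im, dotU_re, Prod.fst_add, Prod.snd_add, add_im, one_im, add_zero,
    add_re, one_re] at hz ⊢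
  nlinarith

/-! ## The Laplace–Fourier kernel under the support condition -/

/-- Pointwise majorant of the kernel: `‖e^{−ζE} cos(βp)‖ ≤ e^{−Re ζ·E + c}` whenever `|Im β|·|p| ≤ c`. -/
theorem norm_kernel_le_of_abs_mul_le {ζ β : ℂ} {E p c : ℝ} (hp : |β.im| * |p| ≤ c) :
    ‖Complex.exp (-(ζ * (E : ℂ))) * Complex.cos (β * (p : ℂ))‖ ≤ Real.exp (-(ζ.re * E) + c) := by
  rw [norm_mul, Complex.norm_exp]
  have hre : (-(ζ * (E : ℂ))).re = -(ζ.re * E) := by simp [Complex.mul_re]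
  rw [hre]
  have him : (β * (p : ℂ)).im = β.im * p := by simp [Complex.mul_im]
  have hcos := norm_cos_le (β * (p : ℂ))
  rw [him] at hcos
  have h1 : Real.exp (β.im * p) ≤ Real.exp c :=
    Real.exp_le_exp.2 (((le_abs_self _).trans (abs_mul β.im p).le).trans hp)
  have h2 : Real.exp (-(β.im * p)) ≤ Real.exp c :=
    Real.exp_le_exp.2 (((neg_le_abs _).trans (abs_mul β.im p).le).trans hp)
  have hc : ‖Complex.cos (β * (p : ℂ))‖ ≤ Real.exp c := hcos.trans (by linarith)
  calc Real.exp (-(ζ.re * E)) * ‖Complex.cos (β * (p : ℂ))‖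
      ≤ Real.exp (-(ζ.re * E)) * Real.exp c := mul_le_mul_of_nonneg_left hc (Real.exp_pos _).le
    _ = Real.exp (-(ζ.re * E) + c) := by rw [← Real.exp_add]

/-- Under aperture `τ > 0` the Laplace–Fourier measure is carried by `{τ|p| ≤ E}`. -/
theorem ae_mul_abs_le_of_hasAperture {μ : Measure (ℝ × ℝ)} {τ : ℝ} (h : HasAperture μ τ) :
    ∀ᵐ z ∂μ, τ * |z.2| ≤ z.1 := by
  rw [ae_iff]
  have : {z : ℝ × ℝ | ¬ τ * |z.2| ≤ z.1} = {z : ℝ × ℝ | z.1 < τ * |z.2|} := by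
    ext z; simp [not_le]
  rw [this]
  exact h

variable {k : E2 → ℝ} {μ : Measure (ℝ × ℝ)} {τ : ℝ}

/-- The axis function `s ↦ ∫ e^{−sE} dμ` is `k(s, 0)`. -/
theorem integral_exp_neg_eq (hLF : IsPlanarLF k μ) {s : ℝ} (hs : 0 < s) :
    ∫ z : ℝ × ℝ, Real.exp (-(s * z.1)) ∂μ = k (mk2 s 0) := by
  rw [(hLF.2 s hs).2 0]
  refine integral_congr_ae (Eventually.of_forall fun z => ?_)
  simp [mul_comm]

/-- The axis function is non-negative … -/
theorem k_axis_nonneg (hLF : IsPlanarLF k μ) {s : ℝ} (hs : 0 < s) : 0 ≤ k (mk2 s 0) := by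
  rw [← integral_exp_neg_eq hLF hs]
  exact integral_nonneg fun z => (Real.exp_pos _).le

/-- … and antitone on `(0, ∞)`. -/
theorem k_axis_antitone (hLF : IsPlanarLF k μ) {s s' : ℝ} (hs : 0 < s) (hss' : s ≤ s') :
    k (mk2 s' 0) ≤ k (mk2 s 0) := by
  have hs' : 0 < s' := lt_of_lt_of_le hs hss'
  rw [← integral_exp_neg_eq hLF hs, ← integral_exp_neg_eq hLF hs']
  refine integral_mono_ae (hLF.2 s' hs').1 (hLF.2 s hs).1 ?_
  filter_upwards [ae_energy_nonneg hLF.1] with z hz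
  exact Real.exp_le_exp.2 (by nlinarith)

/-- **H1 (a): holomorphy of `F₀` on the frame-`0` tube of aperture `τ`** (dominated holomorphic parameter integral; the dominator
comes from the SUPPORT condition `τ|p| ≤ E`). -/
theorem differentiableOn_F0 (hLF : IsPlanarLF k μ) (hap : HasAperture μ τ) (hτ : 0 < τ) :
    DifferentiableOn ℂ (F0 μ) (T0 τ) := by
  have hae0 : ∀ᵐ z ∂μ, 0 ≤ z.1 := ae_energy_nonneg hLF.1
  have haeC : ∀ᵐ z ∂μ, τ * |z.2| ≤ z.1 := ae_mul_abs_le_of_hasAperture hap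
  have hKc : ∀ q : ℂ × ℂ, Continuous fun z : ℝ × ℝ =>
      Complex.exp (-(q.1 * (z.1 : ℂ))) * Complex.cos (q.2 * (z.2 : ℂ)) := fun q => by fun_prop
  have hKd : ∀ z : ℝ × ℝ, Differentiable ℂ fun q : ℂ × ℂ =>
      Complex.exp (-(q.1 * (z.1 : ℂ))) * Complex.cos (q.2 * (z.2 : ℂ)) := fun z => by fun_prop
  refine Literature.Analysis.Complex.differentiableOn_integral_of_dominated (fun q _ => (hKc q).aestronglyMeasurable)
    (Eventually.of_forall fun z => (hKd z).differentiableOn) ?_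
  intro q₀ hq₀
  have hq₀' : |q₀.2.im| < τ * q₀.1.re := hq₀
  set m : ℝ := τ * q₀.1.re - |q₀.2.im| with hm
  have hmpos : 0 < m := by rw [hm]; linarith
  set R : ℝ := m / (2 * (1 + τ)) with hR
  have hRpos : 0 < R := by rw [hR]; positivity
  have hRm : R * (1 + τ) = m / 2 := by rw [hR]; field_simp
  have hbasic : ∀ q : ℂ × ℂ, q ∈ ball q₀ R → q₀.1.re - R < q.1.re ∧ |q.2.im| < |q₀.2.im| + R := by
    intro q hq
    rw [mem_ball, Prod.dist_eq, max_lt_iff] at hq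
    have h1 : |q.1.re - q₀.1.re| < R := lt_of_le_of_lt (by
      simpa using Complex.abs_re_le_norm (q.1 - q₀.1)) (by rw [← dist_eq_norm]; exact hq.1)
    have h2 : |q.2.im - q₀.2.im| < R := lt_of_le_of_lt (by
      simpa using Complex.abs_im_le_norm (q.2 - q₀.2)) (by rw [← dist_eq_norm]; exact hq.2)
    rw [abs_lt] at h1
    have h3 := abs_add_le (q.2.im - q₀.2.im) q₀.2.im
    rw [sub_add_cancel] at h3
    exact ⟨by linarith, by linarith⟩
  -- the margin of the dominator
  set s : ℝ := m / (2 * τ) with hs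
  have hspos : 0 < s := by rw [hs]; positivity
  have hInt := (hLF.2 s hspos).1
  refine ⟨R, hRpos, ?_, fun z => Real.exp (-(s * z.1)) + Real.exp (-(s * z.1)), hInt.add hInt, ?_⟩
  · intro q hq
    obtain ⟨h1, h2⟩ := hbasic q hq
    show |q.2.im| < τ * q.1.re
    nlinarith
  · filter_upwards [hae0, haeC] with z hz hzC q hq
    obtain ⟨h1, h2⟩ := hbasic q hq
    have hζ : q₀.1.re - R ≤ q.1.re := h1.le
    have hσ : |q.2.im| ≤ |q₀.2.im| + R := h2.le
    refine (norm_kernel_le hz hζ hσ).trans ?_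
    -- `τ|p| ≤ E` ⇒ `(|Im β₀| + R)|p| ≤ (|Im β₀| + R) E/τ`, and the exponent is `≤ -s E`
    have hp : |z.2| ≤ z.1 / τ := by rw [le_div_iff₀ hτ]; linarith
    have hβ₁ : 0 ≤ |q₀.2.im| + R := by positivity
    have hkey : (|q₀.2.im| + R) * |z.2| ≤ (|q₀.2.im| + R) * (z.1 / τ) := mul_le_mul_of_nonneg_left hp hβ₁
    have hexp : -((q₀.1.re - R) * z.1) + (|q₀.2.im| + R) * (z.1 / τ) ≤ -(s * z.1) := by
      -- `(q₀.1.re - R) - (|q₀.2.im| + R)/τ = (m - R(1+τ))/τ = s`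
      have : (q₀.1.re - R) - (|q₀.2.im| + R) / τ = s := by
        rw [hs]; field_simp; nlinarith [hRm]
      have hz1 : 0 ≤ z.1 := hz
      have : -((q₀.1.re - R) * z.1) + (|q₀.2.im| + R) * (z.1 / τ) = -(s * z.1) := by
        rw [← this]; field_simp; ring
      exact this.le
    refine add_le_add (Real.exp_le_exp.2 ?_) (Real.exp_le_exp.2 ?_)
    · have : (|q₀.2.im| + R) * z.2 ≤ (|q₀.2.im| + R) * |z.2| := mul_le_mul_of_nonneg_left (le_abs_self _) hβ₁
      linarith
    · have : -(|q₀.2.im| + R) * z.2 ≤ (|q₀.2.im| + R) * |z.2| := by nlinarith [neg_abs_le z.2]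
      linarith

/-- **H1 (b): the frame majorant** `‖F₀(ζ, β)‖ ≤ k(Re ζ − |Im β|/τ, 0)` on `T₀`. -/
theorem norm_F0_le (hLF : IsPlanarLF k μ) (hap : HasAperture μ τ) (hτ : 0 < τ) {q : ℂ × ℂ} (hq : q ∈ T0 τ) :
    ‖F0 μ q‖ ≤ k (mk2 (q.1.re - |q.2.im| / τ) 0) := by
  have hq' : |q.2.im| < τ * q.1.re := hq
  have hs : 0 < q.1.re - |q.2.im| / τ := by
    rw [sub_pos, div_lt_iff₀ hτ]; linarith
  have hInt := (hLF.2 _ hs).1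
  have hbound : ∀ᵐ z ∂μ, ‖Complex.exp (-(q.1 * (z.1 : ℂ))) * Complex.cos (q.2 * (z.2 : ℂ))‖
      ≤ Real.exp (-((q.1.re - |q.2.im| / τ) * z.1)) := by
    filter_upwards [ae_mul_abs_le_of_hasAperture hap] with z hzC
    have hp : |q.2.im| * |z.2| ≤ |q.2.im| * (z.1 / τ) :=
      mul_le_mul_of_nonneg_left (by rw [le_div_iff₀ hτ]; linarith) (abs_nonneg _)
    refine (norm_kernel_le_of_abs_mul_le hp).trans (le_of_eq ?_)
    congr 1; field_simp; ring
  refine (norm_integral_le_of_norm_le hInt hbound).trans (le_of_eq ?_)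
  exact integral_exp_neg_eq hLF hs

/-- **H2: holomorphy of `F₊` on `T₊`** (composition with the linear frame change). -/
theorem differentiableOn_Fplus (hLF : IsPlanarLF k μ) (hap : HasAperture μ τ) (hτ : 0 < τ) :
    DifferentiableOn ℂ (Fplus μ) (Tplus τ) :=
  (differentiableOn_F0 hLF hap hτ).comp differentiable_rot.differentiableOn fun _ hz => hz

/-- **H2: the frame-`+` majorant.** -/
theorem norm_Fplus_le (hLF : IsPlanarLF k μ) (hap : HasAperture μ τ) (hτ : 0 < τ) {q : ℂ × ℂ} (hq : q ∈ Tplus τ) :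
    ‖Fplus μ q‖ ≤ k (mk2 ((dotU q).re - |(dotUperp q).im| / τ) 0) :=
  norm_F0_le hLF hap hτ hq

/-- `F₀` is even in `β`. -/
theorem F0_neg_snd (μ : Measure (ℝ × ℝ)) (ζ β : ℂ) : F0 μ (ζ, -β) = F0 μ (ζ, β) := by
  unfold F0
  refine integral_congr_ae (Eventually.of_forall fun z => ?_)
  simp only [neg_mul, Complex.cos_neg]

/-- (a)–(d) are unconditional; hence `FrameAgreement τ → FrameGluing τ` for `τ > 0`. -/
theorem frameGluing_of_frameAgreement (hτ : 0 < τ) (hA : FrameAgreement τ) : FrameGluing τ :=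
  fun k μ hk hLF hap => ⟨differentiableOn_F0 hLF hap hτ, fun _ hz => norm_F0_le hLF hap hτ hz,
    differentiableOn_Fplus hLF hap hτ, fun _ hz => norm_Fplus_le hLF hap hτ hz, hA k μ hk hLF hap⟩

/-- Conversely `FrameGluing τ → FrameAgreement τ`. -/
theorem frameAgreement_of_frameGluing (hG : FrameGluing τ) : FrameAgreement τ :=
  fun k μ hk hLF hap => (hG k μ hk hLF hap).2.2.2.2

end Summit.QuantumFields.YangMills.Theorems.F4SubCurvatureDoorPlanarApertureStepRegistered

end
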